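import Summits.KontsevichZagierPeriods.KontsevichZagierPeriods.Theorems.FurushoPentagonLinStokesSymHyperoctahedralBoundary
import Mathlib.Analysis.Analytic.Uniqueness
import Mathlib.Analysis.Analytic.Constructions

/-!
# `ReducedPeriodRing`, line `lin-stokes-sym`: analytic self-maps of the cube map facets into facets

Helper file for the stub `stub_hyperoctahedralFactorisation` of crux
`FurushoPentagon.ReducedPeriodRing` (stmt-KontsevichZagierPeriods-3929), line `lin-stokes-sym`
(registered sub-goal `stub_hyperoctahedral_facet`). We set up the `2n` facets
`F_{(k,b)} = {x ∈ [0,1]ⁿ | x_k = b}` (`b ∈ {0,1}` coded by `Bool`; file-local notation `F[n, a]`,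
`a = (k, b)`), their relative interiors `F°_{(k,b)} = {x | x_k = b, 0 < x_i < 1 (i ≠ k)}`
(`F°[n, a]`) and their incidences, and prove (`Hyperoctahedral.exists_mapsTo_facet`): if `Φ` is
continuous on the cube `[0,1]ᵐ⁺¹`, has real-analytic coordinates near the cube and maps the
boundary into the boundary, then every facet `F_a` is mapped into a single facet `F_{a'}`.

Proof. In the affine chart `ι(y) = insertNth j b y` of `F_{(j,b)}` the closed sets
`S_{(k,d)} = {y ∈ [0,1]ᵐ | Φ(ι y)_k = d}` cover `[0,1]ᵐ` (boundary goes to boundary), so one of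
them has non-empty interior (a finite union of closed sets with empty interiors has empty
interior); the real-analytic function `y ↦ Φ(ι y)_k − d` vanishes on that open set, hence on the
connected open cube `(0,1)ᵐ` (identity theorem,
`AnalyticOnNhd.eqOn_zero_of_preconnected_of_eventuallyEq_zero`) and by continuity on `[0,1]ᵐ`.

References: S. G. Krantz, H. R. Parks, *A primer of real analytic functions*, 2nd ed. (2002),
§4.1 (identity theorem in several variables); M. Kontsevich, D. Zagier, *Periods* (2001), §1.2.
-/

noncomputable section

namespace Summit.KontsevichZagierPeriods.FurushoPentagon.ReducedPeriodRing.LinStokesSym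

open Set Filter Topology
open Literature.NumberTheory.Transcendental
open Literature.NumberTheory.Transcendental.KZ

namespace Hyperoctahedral

variable {n : ℕ}

/-- The boundary `∂C = {x ∈ [0,1]ⁿ | some xᵢ ∈ {0,1}}` of the closed cube (file-local notation). -/
local notation3 (prettyPrint := false) "∂C[" n "]" =>
  {x : Fin n → ℝ | x ∈ cube n ∧ ∃ i, x i = 0 ∨ x i = 1}

/-! ### Facets of the cube -/

/-- The real value of the side `b ∈ {0,1}` coded by a Boolean, `true ↦ 1`, in the
`if … then 1 else 0` form of the registered statement (file-local notation). -/
local notation3 (prettyPrint := false) "𝕧[" b "]" => (if (b : Bool) then (1 : ℝ) else 0)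

/-- The facet `F_{(k,b)} = {x ∈ [0,1]ⁿ | x_k = b}` of the closed cube, `a = (k, b)` (file-local
notation). -/
local notation3 (prettyPrint := false) "F[" n ", " a "]" =>
  {x : Fin n → ℝ | x ∈ cube n ∧ x (Prod.fst a) = 𝕧[Prod.snd a]}

/-- The relative interior `F°_{(k,b)} = {x | x_k = b, 0 < x_i < 1 (i ≠ k)}` of a facet (file-local
notation). -/
local notation3 (prettyPrint := false) "F°[" n ", " a "]" =>
  {x : Fin n → ℝ | x (Prod.fst a) = 𝕧[Prod.snd a] ∧ ∀ i, i ≠ Prod.fst a → 0 < x i ∧ x i < 1}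

/-- The centre of the facet `F_a`: coordinate `a.1` equal to the side, all others `1/2` (file-local
notation). -/
local notation3 (prettyPrint := false) "ctr[" n ", " a "]" =>
  (fun i : Fin n => if i = Prod.fst a then 𝕧[Prod.snd a] else (1 / 2 : ℝ))

/-- The affine chart `ℝᵐ → ℝᵐ⁺¹` of the hyperplane `{x_j = c}`: insert the constant `c` as `j`-th
coordinate (Mathlib `Fin.insertNth`; file-local notation). -/
local notation3 (prettyPrint := false) "ι[" j ", " c ", " y "]" =>
  (Fin.insertNth j c y : Fin (_ + 1) → ℝ)

/-- The coding of sides is injective. [folklore] -/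
theorem bval_injective {b b' : Bool} (h : 𝕧[b] = 𝕧[b']) : b = b' := by
  revert h
  cases b <;> cases b' <;> simp

/-- The value of a side is `0` or `1`. [folklore] -/
theorem bval_eq_zero_or_one (b : Bool) : 𝕧[b] = 0 ∨ 𝕧[b] = 1 := by cases b <;> simp

/-- The value of a side lies in `[0,1]`. [folklore] -/
theorem bval_mem_Icc (b : Bool) : 0 ≤ 𝕧[b] ∧ 𝕧[b] ≤ 1 := by cases b <;> simp

/-- The opposite side, in the `if … then 0 else 1` form of the registered statement. [folklore] -/
theorem bval_not_eq_ite (b : Bool) : 𝕧[!b] = if b then 0 else 1 := by cases b <;> simp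

/-- A real number in `{0, 1}` is the value of a side. [folklore] -/
theorem exists_bval_eq {c : ℝ} (hc : c = 0 ∨ c = 1) : ∃ b, 𝕧[b] = c := by
  rcases hc with rfl | rfl
  exacts [⟨false, by simp⟩, ⟨true, by simp⟩]

/-- Facets lie in the cube. [folklore] -/
theorem facet_subset_cube {a : Fin n × Bool} : F[n, a] ⊆ cube n := fun _ hx => hx.1

/-- Facets lie in the boundary. [folklore] -/
theorem facet_subset_bdry {a : Fin n × Bool} : F[n, a] ⊆ ∂C[n] := fun x hx =>
  ⟨hx.1, a.1, by rw [hx.2]; exact bval_eq_zero_or_one a.2⟩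

/-- The relative interior of a facet lies in the facet. [folklore] -/
theorem rfacet_subset_facet {a : Fin n × Bool} : F°[n, a] ⊆ F[n, a] := fun x hx => by
  refine ⟨fun i => ?_, hx.1⟩
  by_cases hi : i = a.1
  · rw [hi, hx.1]
    exact bval_mem_Icc a.2
  · exact ⟨(hx.2 i hi).1.le, (hx.2 i hi).2.le⟩

/-- Every boundary point lies in a facet. [folklore] -/
theorem exists_mem_facet_of_mem_bdry {x : Fin n → ℝ} (hx : x ∈ ∂C[n]) : ∃ a, x ∈ F[n, a] := by
  obtain ⟨hxC, i, hi⟩ := hx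
  obtain ⟨b, hb⟩ := exists_bval_eq hi
  exact ⟨(i, b), hxC, hb.symm⟩

/-- A point of the relative interior of a facet lies in no other facet. [folklore] -/
theorem eq_of_mem_rfacet_of_mem_facet {a a' : Fin n × Bool} {x : Fin n → ℝ} (ha : x ∈ F°[n, a])
    (ha' : x ∈ F[n, a']) : a' = a := by
  have h1 : a'.1 = a.1 := by
    by_contra h
    have hlt := ha.2 a'.1 h
    rcases bval_eq_zero_or_one a'.2 with h0 | h0
    · exact hlt.1.ne' (ha'.2.trans h0)
    · exact hlt.2.ne (ha'.2.trans h0)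
  refine Prod.ext h1 (bval_injective ?_)
  rw [← ha'.2, h1, ha.1]

/-- Facets are closed. [folklore] -/
theorem isClosed_facet {a : Fin n × Bool} : IsClosed (F[n, a]) :=
  isClosed_cube.inter (isClosed_eq (continuous_apply a.1) continuous_const)

/-- Facets are compact. [folklore] -/
theorem isCompact_facet {a : Fin n × Bool} : IsCompact (F[n, a]) :=
  isCompact_cube.of_isClosed_subset isClosed_facet facet_subset_cube

/-- The centre of a facet lies in its relative interior. [folklore] -/
theorem facetCenter_mem_rfacet {a : Fin n × Bool} : ctr[n, a] ∈ F°[n, a] := by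
  refine ⟨by simp, fun i hi => ?_⟩
  simp only [if_neg hi]
  norm_num

/-- Relative facet interiors are non-empty. [folklore] -/
theorem rfacet_nonempty {a : Fin n × Bool} : (F°[n, a]).Nonempty := ⟨_, facetCenter_mem_rfacet⟩

/-- A facet lies in the closure of its relative interior: the open segment from the centre of the
facet to any of its points lies in the relative interior. [folklore] -/
theorem facet_subset_closure_rfacet {a : Fin n × Bool} : F[n, a] ⊆ closure (F°[n, a]) := by
  intro x hx
  have hseg : openSegment ℝ (ctr[n, a]) x ⊆ F°[n, a] := by
    rintro _ ⟨s, t, hs, ht, hst, rfl⟩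
    refine ⟨?_, fun i hi => ?_⟩
    · simp only [Pi.add_apply, Pi.smul_apply, smul_eq_mul, if_true, hx.2]
      rw [← add_mul, hst, one_mul]
    · simp only [Pi.add_apply, Pi.smul_apply, smul_eq_mul, if_neg hi]
      have h0 := (hx.1 i).1
      have h1 := (hx.1 i).2
      constructor <;> nlinarith
  exact closure_mono hseg (segment_subset_closure_openSegment (right_mem_segment ℝ _ _))

/-- Two facets in different coordinate directions meet. [folklore] -/
theorem facet_inter_facet_nonempty {a a' : Fin n × Bool} (h : a.1 ≠ a'.1) :
    (F[n, a] ∩ F[n, a']).Nonempty := by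
  have hpC : (fun i => if i = a.1 then 𝕧[a.2] else if i = a'.1 then 𝕧[a'.2] else (0 : ℝ)) ∈
      cube n := by
    intro i
    dsimp only
    by_cases h1 : i = a.1
    · rw [if_pos h1]
      exact bval_mem_Icc a.2
    · rw [if_neg h1]
      by_cases h2 : i = a'.1
      · rw [if_pos h2]
        exact bval_mem_Icc a'.2
      · rw [if_neg h2]
        norm_num
  exact ⟨_, ⟨hpC, by simp⟩, ⟨hpC, by simp [Ne.symm h]⟩⟩

/-- Opposite facets are disjoint. [folklore] -/
theorem facet_inter_facet_opposite (k : Fin n) (b : Bool) :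
    F[n, (k, b)] ∩ F[n, (k, !b)] = ∅ := by
  ext x
  simp only [mem_inter_iff, mem_setOf_eq, mem_empty_iff_false, iff_false, not_and, and_imp]
  intro _ h1 _ h2
  have := bval_injective (h1.symm.trans h2)
  cases b <;> simp at this

/-- Two disjoint facets are opposite (in positive dimension every facet is non-empty). [folklore] -/
theorem eq_opposite_of_facet_inter_eq_empty {a a' : Fin n × Bool}
    (h : F[n, a] ∩ F[n, a'] = ∅) : a' = (a.1, !a.2) := by
  have h1 : a'.1 = a.1 := by
    by_contra hne
    exact (facet_inter_facet_nonempty (Ne.symm hne)).ne_empty h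
  refine Prod.ext h1 ?_
  cases hb : a'.2 <;> cases hb' : a.2
  · exfalso
    have : a' = a := Prod.ext h1 (hb.trans hb'.symm)
    rw [this, inter_self] at h
    exact (rfacet_nonempty.mono rfacet_subset_facet).ne_empty h
  · rfl
  · rfl
  · exfalso
    have : a' = a := Prod.ext h1 (hb.trans hb'.symm)
    rw [this, inter_self] at h
    exact (rfacet_nonempty.mono rfacet_subset_facet).ne_empty h

/-! ### The face charts -/

section FaceChart

variable {m : ℕ}

/-- The face chart is continuous. [folklore] -/
theorem continuous_faceChart (j : Fin (m + 1)) (c : ℝ) :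
    Continuous fun y : Fin m → ℝ => ι[j, c, y] :=
  continuous_const.finInsertNth j continuous_id

/-- The face chart is real-analytic (it is affine). [folklore] -/
theorem analyticAt_faceChart (j : Fin (m + 1)) (c : ℝ) (y : Fin m → ℝ) :
    AnalyticAt ℝ (fun y : Fin m → ℝ => ι[j, c, y]) y := by
  refine AnalyticAt.pi (f := fun l (y : Fin m → ℝ) => ι[j, c, y] l) fun l => ?_
  refine Fin.succAboveCases j ?_ (fun i => ?_) l
  · simp only [Fin.insertNth_apply_same]
    exact analyticAt_const
  · simp only [Fin.insertNth_apply_succAbove]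
    exact (analyticAt_pi_iff (f := fun (i : Fin m) (x : Fin m → ℝ) => x i)).1 analyticAt_id i

/-- The face chart with `0 ≤ c ≤ 1` maps the cube `[0,1]ᵐ` into the cube `[0,1]ᵐ⁺¹`. [folklore] -/
theorem faceChart_mem_cube {j : Fin (m + 1)} {c : ℝ} (hc : 0 ≤ c ∧ c ≤ 1) {y : Fin m → ℝ}
    (hy : y ∈ cube m) : ι[j, c, y] ∈ cube (m + 1) := fun l => by
  refine Fin.succAboveCases j ?_ (fun i => ?_) l
  · simpa using hc
  · simpa using hy i

/-- The face chart of side `b` maps the cube `[0,1]ᵐ` into the facet `F_{(j,b)}`. [folklore] -/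
theorem faceChart_mem_facet (j : Fin (m + 1)) (b : Bool) {y : Fin m → ℝ} (hy : y ∈ cube m) :
    ι[j, 𝕧[b], y] ∈ F[m + 1, (j, b)] :=
  ⟨faceChart_mem_cube (bval_mem_Icc b) hy, by simp⟩

/-- A point of the hyperplane `{x_j = c}` is the face chart of its remaining coordinates.
[folklore] -/
theorem faceChart_removeNth {j : Fin (m + 1)} {c : ℝ} {x : Fin (m + 1) → ℝ} (hx : x j = c) :
    ι[j, c, j.removeNth x] = x := by
  subst hx
  exact Fin.insertNth_self_removeNth j x

/-- Removing a coordinate keeps a point of the cube in the cube. [folklore] -/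
theorem removeNth_mem_cube (j : Fin (m + 1)) {x : Fin (m + 1) → ℝ} (hx : x ∈ cube (m + 1)) :
    j.removeNth x ∈ cube m := fun i => hx (j.succAbove i)

end FaceChart

/-! ### Each facet is mapped into a facet -/

/-- **Each facet goes into one facet.** Let `Φ` be continuous on the cube `[0,1]ᵐ⁺¹`, with
coordinates real-analytic near the cube, mapping the boundary into the boundary. Then for every
facet `F_a` there is a facet `F_{a'}` with `Φ(F_a) ⊆ F_{a'}`. Proof: in the chart
`ι = ι[j, b, ·]` of `F_a` the closed sets `S_{(k,d)} = {y ∈ [0,1]ᵐ | Φ(ι y)_k = d}` cover the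
cube (boundary goes to boundary), so one of them has non-empty interior (finite Baire principle);
the analytic function `y ↦ Φ(ι y)_k − d` then vanishes on an open subset of the (connected) open
cube, hence on the open cube (identity theorem) and by continuity on the closed cube. [folklore] -/
theorem exists_mapsTo_facet {m : ℕ} {Φ : (Fin (m + 1) → ℝ) → (Fin (m + 1) → ℝ)}
    (hc : ContinuousOn Φ (cube (m + 1)))
    (han : ∀ i, AnalyticOnNhd ℝ (fun x => Φ x i) (cube (m + 1)))
    (hb : MapsTo Φ (∂C[m + 1]) (∂C[m + 1])) (a : Fin (m + 1) × Bool) :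
    ∃ a', MapsTo Φ (F[m + 1, a]) (F[m + 1, a']) := by
  obtain ⟨j, b⟩ := a
  -- the chart of the facet and the closed sets `S k`
  have hιC : ∀ y ∈ cube m, ι[j, 𝕧[b], y] ∈ cube (m + 1) := fun y hy =>
    faceChart_mem_cube (bval_mem_Icc b) hy
  have hcont : ∀ k : Fin (m + 1), ContinuousOn (fun y => Φ (ι[j, 𝕧[b], y]) k) (cube m) :=
    fun k => (continuous_apply k).comp_continuousOn
      (hc.comp (continuous_faceChart j 𝕧[b]).continuousOn hιC)
  set S : Fin (m + 1) × Bool → Set (Fin m → ℝ) :=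
    fun k => {y | y ∈ cube m ∧ Φ (ι[j, 𝕧[b], y]) k.1 = 𝕧[k.2]} with hS
  have hclosed : ∀ k, IsClosed (S k) := fun k =>
    (hcont k.1).preimage_isClosed_of_isClosed isClosed_cube isClosed_singleton
  have hcover : cube m ⊆ ⋃ k ∈ (Finset.univ : Finset (Fin (m + 1) × Bool)), S k := by
    intro y hy
    obtain ⟨k, hk⟩ :=
      exists_mem_facet_of_mem_bdry (hb (facet_subset_bdry (faceChart_mem_facet j b hy)))
    exact mem_biUnion (Finset.mem_univ k) ⟨hy, hk.2⟩
  -- one of the `S k` has non-empty interior (finite Baire principle)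
  obtain ⟨k, z₀, hz₀⟩ : ∃ k, (interior (S k)).Nonempty := by
    by_contra h
    push Not at h
    have hempty : interior (⋃ k ∈ (Finset.univ : Finset (Fin (m + 1) × Bool)), S k) = ∅ :=
      Literature.ModelTheory.ExponentialFields.interior_biUnion_finset_eq_empty _ S
        (fun k _ => hclosed k) fun k _ => h k
    have hcenter : (fun _ => (1 / 2 : ℝ)) ∈
        interior (⋃ k ∈ (Finset.univ : Finset (Fin (m + 1) × Bool)), S k) :=
      interior_mono hcover (by rw [interior_cube]; exact center_mem_openUnitCube)
    rw [hempty] at hcenter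
    exact hcenter
  -- the identity theorem for `g = Φ(ι ·)_k - d` on the open cube
  have hWsub : interior (S k) ⊆ openUnitCube m := by
    rw [← interior_cube]
    exact interior_mono fun y hy => hy.1
  set g : (Fin m → ℝ) → ℝ := fun y => Φ (ι[j, 𝕧[b], y]) k.1 - 𝕧[k.2] with hg
  have hgan : AnalyticOnNhd ℝ g (openUnitCube m) := fun y hy =>
    ((han k.1 _ (hιC y (openUnitCube_subset_cube hy))).comp (analyticAt_faceChart j 𝕧[b] y)).sub
      analyticAt_const
  have hev : g =ᶠ[𝓝 z₀] 0 :=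
    Filter.eventuallyEq_of_mem (isOpen_interior.mem_nhds hz₀) fun y hy => by
      have hyS : y ∈ S k := interior_subset hy
      simp only [hg, hyS.2, sub_self, Pi.zero_apply]
  have hzero : EqOn g 0 (openUnitCube m) :=
    hgan.eqOn_zero_of_preconnected_of_eventuallyEq_zero isPreconnected_openUnitCube (hWsub hz₀) hev
  have hgc : ContinuousOn g (cube m) := (hcont k.1).sub continuousOn_const
  have hzero' : EqOn g 0 (cube m) :=
    hzero.of_subset_closure hgc continuousOn_const openUnitCube_subset_cube
      (closure_openUnitCube m).symm.subset
  -- conclusion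
  refine ⟨k, fun x hx => ⟨(hb (facet_subset_bdry hx)).1, ?_⟩⟩
  have h0 := hzero' (removeNth_mem_cube j hx.1)
  simp only [hg, Pi.zero_apply, faceChart_removeNth hx.2, sub_eq_zero] at h0
  exact h0

end Hyperoctahedral

/-- Anchor of this helper file (registered sub-goal `stub_hyperoctahedral_facet` of crux
stmt-KontsevichZagierPeriods-3929, serving `stub_hyperoctahedralFactorisation` of line
`lin-stokes-sym`): a continuous self-map of the cube `[0,1]ᵐ⁺¹` with real-analytic coordinates
near the cube which maps boundary points to boundary points maps each facet `{x_j = b}` into a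
single facet `{u_k = b'}` (`Hyperoctahedral.exists_mapsTo_facet`). [folklore] -/
theorem stub_hyperoctahedral_facet : ∀ (m : ℕ) (Φ : (Fin (m + 1) → ℝ) → (Fin (m + 1) → ℝ)), ContinuousOn Φ (cube (m + 1)) → (∀ i : Fin (m + 1), AnalyticOnNhd ℝ (fun x => Φ x i) (cube (m + 1))) → (∀ x ∈ cube (m + 1), (∃ i, x i = 0 ∨ x i = 1) → Φ x ∈ cube (m + 1) ∧ ∃ k, Φ x k = 0 ∨ Φ x k = 1) → ∀ (j : Fin (m + 1)) (b : Bool), ∃ (k : Fin (m + 1)) (b' : Bool), ∀ x ∈ cube (m + 1), x j = (if b then 1 else 0) → Φ x k = (if b' then 1 else 0) := by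
  intro m Φ hc han hb j b
  obtain ⟨⟨k, b'⟩, hk⟩ :=
    Hyperoctahedral.exists_mapsTo_facet hc han (fun x hx => hb x hx.1 hx.2) (j, b)
  exact ⟨k, b', fun x hx hxj => (hk ⟨hx, hxj⟩).2⟩

end Summit.KontsevichZagierPeriods.FurushoPentagon.ReducedPeriodRing.LinStokesSym
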